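import Mathlib
import HarnessLib

/-!
# Translation-finite (representative) continuous functions on a topological group

A continuous real function `u` on a topological group `G` is **translation-finite** (a
*representative function*, *`G`-finite vector* of `C(G, ℝ)`) if its two-sided translates
`x ↦ u(g x h)` span a finite-dimensional space (Bröcker–tom Dieck, *Representations of Compact
Lie Groups*, III §1; Hochschild, *The Structure of Lie Groups*, Ch. II). This file sets up, for
real-valued functions and an arbitrary topological group:

* the translation operators `lTrans g u = u(g ·)`, `rTrans g u = u(· g)`, `invTrans u = u(·⁻¹)`
  as `ℝ`-algebra endomorphisms of `C(G, ℝ)`, and their composition laws;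
* `biSpan u`, the span of the two-sided translates, and the predicate / subalgebra
  `IsTranslationFinite u`, `translationFinite G : Subalgebra ℝ C(G, ℝ)` (closed under `+`, `*`,
  scalars, constants, left and right translations and inversion);
* the **finite expansion** of a translation-finite function (Bröcker–tom Dieck III (1.2)–(1.5)):
  there are finitely many points `yᵢ` and functions `wᵢ ∈ biSpan u` with
  `u(x z) = Σᵢ u(x yᵢ) wᵢ(z)` for all `x, z` (`IsTranslationFinite.exists_expansion`), obtained
  from a finite set of points on which the finite-dimensional space `biSpan u` is determined
  (`Submodule.exists_finset_determining`).

This is the algebra on which the generating functional of a Gaussian convolution semigroup and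
the "Lie algebra" of point derivations of a compact group are built (heat-kernel uniqueness,
`Literature.MathematicalPhysics.QuantumLattice.isGroupHeatKernel_unique_up_to_scale`). The
complex-valued, left-translate version for compact groups used in the automorphic topic is
`Literature.NumberTheory.Automorphic.IsTranslationFinite` (`CompactGroupKFiniteVectors`); the
present file is independent of it (real scalars, two-sided orbit, no measure theory) and does
not import it. No named facts.
-/

noncomputable section

namespace Literature.RepresentationTheory.CompactGroups

variable {G : Type*} [TopologicalSpace G] [Group G] [IsTopologicalGroup G]

/-! ### Translation operators on `C(G, ℝ)` -/

/-- Left translation `(lTrans g u)(x) = u(g x)` as an `ℝ`-algebra endomorphism of `C(G, ℝ)`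
(Bröcker–tom Dieck III §1). [folklore] -/
def lTrans (g : G) : C(G, ℝ) →ₐ[ℝ] C(G, ℝ) where
  toFun u := u.comp ⟨fun x => g * x, by fun_prop⟩
  map_one' := rfl
  map_mul' _ _ := rfl
  map_zero' := rfl
  map_add' _ _ := rfl
  commutes' _ := rfl

/-- Right translation `(rTrans g u)(x) = u(x g)` as an `ℝ`-algebra endomorphism of `C(G, ℝ)`.
[folklore] -/
def rTrans (g : G) : C(G, ℝ) →ₐ[ℝ] C(G, ℝ) where
  toFun u := u.comp ⟨fun x => x * g, by fun_prop⟩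
  map_one' := rfl
  map_mul' _ _ := rfl
  map_zero' := rfl
  map_add' _ _ := rfl
  commutes' _ := rfl

/-- Inversion `(invTrans u)(x) = u(x⁻¹)` as an `ℝ`-algebra endomorphism of `C(G, ℝ)`. [folklore] -/
def invTrans : C(G, ℝ) →ₐ[ℝ] C(G, ℝ) where
  toFun u := u.comp ⟨fun x : G => x⁻¹, continuous_inv⟩
  map_one' := rfl
  map_mul' _ _ := rfl
  map_zero' := rfl
  map_add' _ _ := rfl
  commutes' _ := rfl

/-- Unfolding `lTrans`. [folklore] -/
@[simp] theorem lTrans_apply (g : G) (u : C(G, ℝ)) (x : G) : lTrans g u x = u (g * x) := rfl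
/-- Unfolding `rTrans`. [folklore] -/
@[simp] theorem rTrans_apply (g : G) (u : C(G, ℝ)) (x : G) : rTrans g u x = u (x * g) := rfl
/-- Unfolding `invTrans`. [folklore] -/
@[simp] theorem invTrans_apply (u : C(G, ℝ)) (x : G) : invTrans u x = u x⁻¹ := rfl

/-- `lTrans 1 = id`. [folklore] -/
@[simp] theorem lTrans_one (u : C(G, ℝ)) : lTrans (1 : G) u = u := by ext x; simp

/-- `rTrans 1 = id`. [folklore] -/
@[simp] theorem rTrans_one (u : C(G, ℝ)) : rTrans (1 : G) u = u := by ext x; simp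

/-- `lTrans g ∘ lTrans h = lTrans (h g)` (a right action). [folklore] -/
theorem lTrans_lTrans (g h : G) (u : C(G, ℝ)) : lTrans g (lTrans h u) = lTrans (h * g) u := by
  ext x; simp [mul_assoc]

/-- `rTrans g ∘ rTrans h = rTrans (g h)`. [folklore] -/
theorem rTrans_rTrans (g h : G) (u : C(G, ℝ)) : rTrans g (rTrans h u) = rTrans (g * h) u := by
  ext x; simp [mul_assoc]

/-- Left and right translations commute. [folklore] -/
theorem lTrans_rTrans (g h : G) (u : C(G, ℝ)) : lTrans g (rTrans h u) = rTrans h (lTrans g u) := by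
  ext x; simp [mul_assoc]

/-- `invTrans` is an involution. [folklore] -/
@[simp] theorem invTrans_invTrans (u : C(G, ℝ)) : invTrans (invTrans u) = u := by ext x; simp

/-- Inversion exchanges left and right translations: `(lTrans g (rTrans h u))ˇ = …`; precisely
`invTrans (lTrans g (rTrans h u)) = lTrans h⁻¹ (rTrans g⁻¹ (invTrans u))`. [folklore] -/
theorem invTrans_lTrans_rTrans (g h : G) (u : C(G, ℝ)) :
    invTrans (lTrans g (rTrans h u)) = lTrans h⁻¹ (rTrans g⁻¹ (invTrans u)) := by
  ext x; simp [mul_assoc, mul_inv_rev]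

/-! ### The span of the two-sided translates -/

/-- The set of two-sided translates `x ↦ u(g x h)` of `u`. [folklore] -/
def biOrbit (u : C(G, ℝ)) : Set C(G, ℝ) :=
  Set.range fun gh : G × G => lTrans gh.1 (rTrans gh.2 u)

/-- The linear span of the two-sided translates of `u` (Bröcker–tom Dieck III §1). [folklore] -/
def biSpan (u : C(G, ℝ)) : Submodule ℝ C(G, ℝ) :=
  Submodule.span ℝ (biOrbit u)

/-- Translates are in the orbit. [folklore] -/
theorem mem_biOrbit (u : C(G, ℝ)) (g h : G) : lTrans g (rTrans h u) ∈ biOrbit u := ⟨(g, h), rfl⟩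

/-- `u ∈ biSpan u`. [folklore] -/
theorem self_mem_biSpan (u : C(G, ℝ)) : u ∈ biSpan u := by
  have h := mem_biOrbit u 1 1
  rw [rTrans_one, lTrans_one] at h
  exact Submodule.subset_span h

/-- `biSpan u` is stable under left translations. [folklore] -/
theorem lTrans_mem_biSpan {u v : C(G, ℝ)} (g : G) (hv : v ∈ biSpan u) : lTrans g v ∈ biSpan u := by
  rw [biSpan] at hv ⊢
  refine Submodule.span_induction (p := fun v _ => lTrans g v ∈ Submodule.span ℝ (biOrbit u))
    ?_ ?_ ?_ ?_ hv
  · rintro _ ⟨⟨g', h'⟩, rfl⟩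
    refine Submodule.subset_span ?_
    rw [lTrans_lTrans]
    exact mem_biOrbit u _ _
  · simp
  · intro a b _ _ ha hb; simpa using Submodule.add_mem _ ha hb
  · intro c a _ ha; simpa using Submodule.smul_mem _ c ha

/-- `biSpan u` is stable under right translations. [folklore] -/
theorem rTrans_mem_biSpan {u v : C(G, ℝ)} (g : G) (hv : v ∈ biSpan u) : rTrans g v ∈ biSpan u := by
  rw [biSpan] at hv ⊢
  refine Submodule.span_induction (p := fun v _ => rTrans g v ∈ Submodule.span ℝ (biOrbit u))
    ?_ ?_ ?_ ?_ hv
  · rintro _ ⟨⟨g', h'⟩, rfl⟩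
    refine Submodule.subset_span ?_
    rw [← lTrans_rTrans, rTrans_rTrans]
    exact mem_biOrbit u _ _
  · simp
  · intro a b _ _ ha hb; simpa using Submodule.add_mem _ ha hb
  · intro c a _ ha; simpa using Submodule.smul_mem _ c ha

/-- Translates of `u` lie in `biSpan u`. [folklore] -/
theorem lTrans_rTrans_self_mem_biSpan (u : C(G, ℝ)) (g h : G) : lTrans g (rTrans h u) ∈ biSpan u :=
  Submodule.subset_span (mem_biOrbit u g h)

/-- `biSpan` of a translate is contained in `biSpan u`. [folklore] -/
theorem biSpan_le_of_mem {u v : C(G, ℝ)} (hv : v ∈ biSpan u) : biSpan v ≤ biSpan u := by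
  refine Submodule.span_le.mpr ?_
  rintro _ ⟨⟨g, h⟩, rfl⟩
  exact lTrans_mem_biSpan g (rTrans_mem_biSpan h hv)

/-! ### Translation-finite functions -/

/-- `u` is **translation-finite** (a representative function): its two-sided translates span a
finite-dimensional space (Bröcker–tom Dieck III (1.1)–(1.2)). [folklore] -/
def IsTranslationFinite (u : C(G, ℝ)) : Prop :=
  FiniteDimensional ℝ (biSpan u)

/-- Unfolding `IsTranslationFinite`. [folklore] -/
theorem IsTranslationFinite.finiteDimensional {u : C(G, ℝ)} (h : IsTranslationFinite u) :
    FiniteDimensional ℝ (biSpan u) := h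

/-- A function whose `biSpan` lies in a finite-dimensional subspace is translation-finite.
[folklore] -/
theorem IsTranslationFinite.of_le {u : C(G, ℝ)} {F : Submodule ℝ C(G, ℝ)}
    [FiniteDimensional ℝ F] (h : biSpan u ≤ F) : IsTranslationFinite u :=
  Submodule.finiteDimensional_of_le h

/-- Elements of `biSpan` of a translation-finite function are translation-finite. [folklore] -/
theorem IsTranslationFinite.of_mem_biSpan {u v : C(G, ℝ)} (hu : IsTranslationFinite u)
    (hv : v ∈ biSpan u) : IsTranslationFinite v :=
  haveI := hu.finiteDimensional
  IsTranslationFinite.of_le (biSpan_le_of_mem hv)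

/-- Left translates of translation-finite functions are translation-finite. [folklore] -/
theorem IsTranslationFinite.left {u : C(G, ℝ)} (hu : IsTranslationFinite u) (g : G) :
    IsTranslationFinite (lTrans g u) :=
  hu.of_mem_biSpan (by simpa using lTrans_rTrans_self_mem_biSpan u g 1)

/-- Right translates of translation-finite functions are translation-finite. [folklore] -/
theorem IsTranslationFinite.right {u : C(G, ℝ)} (hu : IsTranslationFinite u) (g : G) :
    IsTranslationFinite (rTrans g u) :=
  hu.of_mem_biSpan (by simpa using lTrans_rTrans_self_mem_biSpan u 1 g)

/-- `biSpan (invTrans u) = (biSpan u).map invTrans`. [folklore] -/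
theorem biSpan_invTrans (u : C(G, ℝ)) :
    biSpan (invTrans u) = (biSpan u).map (invTrans (G := G)).toLinearMap := by
  rw [biSpan, biSpan, Submodule.map_span]
  congr 1
  ext v
  constructor
  · rintro ⟨⟨g, h⟩, rfl⟩
    refine ⟨lTrans h⁻¹ (rTrans g⁻¹ u), mem_biOrbit u _ _, ?_⟩
    simp only [AlgHom.toLinearMap_apply]
    rw [invTrans_lTrans_rTrans, inv_inv, inv_inv]
  · rintro ⟨_, ⟨⟨g, h⟩, rfl⟩, rfl⟩
    refine ⟨(h⁻¹, g⁻¹), ?_⟩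
    simp only [AlgHom.toLinearMap_apply]
    rw [invTrans_lTrans_rTrans]

/-- Inverted translation-finite functions are translation-finite. [folklore] -/
theorem IsTranslationFinite.inv {u : C(G, ℝ)} (hu : IsTranslationFinite u) :
    IsTranslationFinite (invTrans u) := by
  haveI := hu.finiteDimensional
  rw [IsTranslationFinite, biSpan_invTrans]
  infer_instance

/-- `biSpan (u + v) ≤ biSpan u ⊔ biSpan v`. [folklore] -/
theorem biSpan_add_le (u v : C(G, ℝ)) : biSpan (u + v) ≤ biSpan u ⊔ biSpan v := by
  refine Submodule.span_le.mpr ?_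
  rintro _ ⟨⟨g, h⟩, rfl⟩
  dsimp only
  rw [map_add, map_add]
  exact Submodule.add_mem_sup (lTrans_rTrans_self_mem_biSpan u g h)
    (lTrans_rTrans_self_mem_biSpan v g h)

/-- `biSpan (c • u) ≤ biSpan u`. [folklore] -/
theorem biSpan_smul_le (c : ℝ) (u : C(G, ℝ)) : biSpan (c • u) ≤ biSpan u := by
  refine Submodule.span_le.mpr ?_
  rintro _ ⟨⟨g, h⟩, rfl⟩
  dsimp only
  rw [map_smul, map_smul]
  exact Submodule.smul_mem _ c (lTrans_rTrans_self_mem_biSpan u g h)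

/-- `biSpan (u * v) ≤ biSpan u * biSpan v` (products of translates are translates of the
product). [folklore] -/
theorem biSpan_mul_le (u v : C(G, ℝ)) : biSpan (u * v) ≤ biSpan u * biSpan v := by
  refine Submodule.span_le.mpr ?_
  rintro _ ⟨⟨g, h⟩, rfl⟩
  dsimp only
  rw [map_mul, map_mul]
  exact Submodule.mul_mem_mul (lTrans_rTrans_self_mem_biSpan u g h)
    (lTrans_rTrans_self_mem_biSpan v g h)

/-- `biSpan` of a constant is at most the constants. [folklore] -/
theorem biSpan_algebraMap_le (c : ℝ) :
    biSpan (algebraMap ℝ C(G, ℝ) c) ≤ Submodule.span ℝ {algebraMap ℝ C(G, ℝ) c} := by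
  refine Submodule.span_le.mpr ?_
  rintro _ ⟨⟨g, h⟩, rfl⟩
  dsimp only
  rw [AlgHom.commutes, AlgHom.commutes]
  exact Submodule.subset_span rfl

variable (G) in
/-- **The subalgebra of translation-finite (representative) functions** of `C(G, ℝ)`
(Bröcker–tom Dieck III (1.2): sums and products of representative functions are
representative). [folklore] -/
def translationFinite : Subalgebra ℝ C(G, ℝ) where
  carrier := {u | IsTranslationFinite u}
  mul_mem' {u v} hu hv := by
    haveI := hu.finiteDimensional; haveI := hv.finiteDimensional
    have hfg : (biSpan u * biSpan v).FG :=
      (Submodule.fg_iff_finiteDimensional _ |>.mpr hu).mul (Submodule.fg_iff_finiteDimensional _ |>.mpr hv)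
    haveI : FiniteDimensional ℝ (biSpan u * biSpan v : Submodule ℝ C(G, ℝ)) :=
      (Submodule.fg_iff_finiteDimensional _).mp hfg
    exact IsTranslationFinite.of_le (biSpan_mul_le u v)
  add_mem' {u v} hu hv := by
    haveI := hu.finiteDimensional; haveI := hv.finiteDimensional
    exact IsTranslationFinite.of_le (biSpan_add_le u v)
  algebraMap_mem' c := IsTranslationFinite.of_le (biSpan_algebraMap_le (G := G) c)

/-- Membership in `translationFinite G`. [folklore] -/
theorem mem_translationFinite_iff {u : C(G, ℝ)} :
    u ∈ translationFinite G ↔ IsTranslationFinite u := Iff.rfl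

/-- The subalgebra of translation-finite functions is stable under left translation. [folklore] -/
theorem lTrans_mem_translationFinite {u : C(G, ℝ)} (hu : u ∈ translationFinite G) (g : G) :
    lTrans g u ∈ translationFinite G := IsTranslationFinite.left hu g

/-- … under right translation. [folklore] -/
theorem rTrans_mem_translationFinite {u : C(G, ℝ)} (hu : u ∈ translationFinite G) (g : G) :
    rTrans g u ∈ translationFinite G := IsTranslationFinite.right hu g

/-- … and under inversion. [folklore] -/
theorem invTrans_mem_translationFinite {u : C(G, ℝ)} (hu : u ∈ translationFinite G) :
    invTrans u ∈ translationFinite G := IsTranslationFinite.inv hu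

/-- `biSpan u ≤ translationFinite G` for translation-finite `u`. [folklore] -/
theorem biSpan_le_translationFinite {u : C(G, ℝ)} (hu : IsTranslationFinite u) :
    biSpan u ≤ Subalgebra.toSubmodule (translationFinite G) :=
  fun _ hv => hu.of_mem_biSpan hv

/-! ### Finite determining sets and the finite expansion `u(xz) = Σ u(x yᵢ) wᵢ(z)` -/

/-- **A finite-dimensional space of functions is determined on a finite set of points**: for a
finite-dimensional subspace `F` of `C(X, ℝ)` there is a finite `s ⊆ X` such that an `f ∈ F`
vanishing on `s` vanishes identically (induction on the dimension: a non-zero `f ∈ F` is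
non-zero at some point `x₀`, and `F ∩ {f | f x₀ = 0}` has smaller dimension). [folklore] -/
theorem _root_.Submodule.exists_finset_determining {X : Type*} [TopologicalSpace X]
    (F : Submodule ℝ C(X, ℝ)) [FiniteDimensional ℝ F] :
    ∃ s : Finset X, ∀ f ∈ F, (∀ x ∈ s, f x = 0) → f = 0 := by
  -- strong induction on `finrank`, over all submodules `K ≤ F`
  suffices h : ∀ n, ∀ K : Submodule ℝ C(X, ℝ), K ≤ F → Module.finrank ℝ K = n →
      ∃ s : Finset X, ∀ f ∈ K, (∀ x ∈ s, f x = 0) → f = 0 from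
    h _ F le_rfl rfl
  intro n
  induction n using Nat.strong_induction_on with
  | _ n ih =>
    intro K hKF hKn
    haveI : FiniteDimensional ℝ K := Submodule.finiteDimensional_of_le hKF
    by_cases hK : K = ⊥
    · refine ⟨∅, fun f hf _ => ?_⟩
      rw [hK, Submodule.mem_bot] at hf
      exact hf
    · obtain ⟨f₀, hf₀K, hf₀⟩ := (Submodule.ne_bot_iff K).mp hK
      obtain ⟨x₀, hx₀⟩ : ∃ x₀, f₀ x₀ ≠ 0 := by
        by_contra! h
        exact hf₀ (ContinuousMap.ext h)
      -- evaluation at `x₀` as a linear map, and `K' = K ∩ ker ev_{x₀}`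
      let ev : C(X, ℝ) →ₗ[ℝ] ℝ :=
        { toFun := fun f => f x₀, map_add' := fun _ _ => rfl, map_smul' := fun _ _ => rfl }
      set K' : Submodule ℝ C(X, ℝ) := K ⊓ LinearMap.ker ev with hK'
      have hlt : K' < K := by
        refine lt_of_le_of_ne inf_le_left fun heq => hx₀ ?_
        have : f₀ ∈ K' := heq ▸ hf₀K
        exact this.2
      have hrank : Module.finrank ℝ K' < n := hKn ▸ Submodule.finrank_lt_finrank_of_lt hlt
      obtain ⟨s', hs'⟩ := ih _ hrank K' (inf_le_left.trans hKF) rfl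
      classical
      refine ⟨insert x₀ s', fun f hfK hzero => ?_⟩
      have hfK' : f ∈ K' := ⟨hfK, hzero x₀ (Finset.mem_insert_self _ _)⟩
      exact hs' f hfK' fun x hx => hzero x (Finset.mem_insert_of_mem hx)

/-- **Finite expansion of a translation-finite function** (Bröcker–tom Dieck III (1.5)): there are
finitely many points `yᵢ` and functions `wᵢ ∈ biSpan u` with `u(x z) = Σᵢ u(x yᵢ) wᵢ(z)` for all
`x, z ∈ G`. Indeed `biSpan u` is determined on a finite set `s` of points, so the restriction
`biSpan u → ℝˢ` has a linear left inverse `L`, and `f = Σ_{y ∈ s} f(y) L(δ_y)` for `f ∈ biSpan u`;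
apply this to the left translates `f = u(x ·)`. [folklore] -/
theorem IsTranslationFinite.exists_expansion {u : C(G, ℝ)} (hu : IsTranslationFinite u) :
    ∃ (s : Finset G) (w : G → C(G, ℝ)),
      (∀ y, w y ∈ biSpan u) ∧ ∀ x z, u (x * z) = ∑ y ∈ s, u (x * y) * w y z := by
  classical
  haveI := hu.finiteDimensional
  obtain ⟨s, hs⟩ := (biSpan u).exists_finset_determining
  -- restriction to `s`
  let res : biSpan u →ₗ[ℝ] (s → ℝ) :=
    { toFun := fun f y => (f : C(G, ℝ)) y
      map_add' := fun _ _ => rfl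
      map_smul' := fun _ _ => rfl }
  have hres : Function.Injective res := by
    refine (injective_iff_map_eq_zero res).mpr fun f hf => ?_
    have : (f : C(G, ℝ)) = 0 := hs f f.2 fun x hx => congrFun hf ⟨x, hx⟩
    exact Subtype.ext this
  obtain ⟨L, hL⟩ := LinearMap.exists_leftInverse_of_injective res (LinearMap.ker_eq_bot.mpr hres)
  let w : G → C(G, ℝ) := fun y =>
    if hy : y ∈ s then (L (Pi.single (⟨y, hy⟩ : s) 1) : C(G, ℝ)) else 0
  have hw : ∀ y : s, w y = (L (Pi.single y 1) : C(G, ℝ)) := fun y => by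
    simp only [w, dif_pos y.2]
  refine ⟨s, w, fun y => ?_, fun x z => ?_⟩
  · by_cases hy : y ∈ s
    · simp only [w, dif_pos hy]; exact (L _).2
    · simp only [w, dif_neg hy]; exact (biSpan u).zero_mem
  -- expand `f = u(x ·) ∈ biSpan u`
  let f : biSpan u := ⟨CompactGroups.lTrans x u, by
    simpa using lTrans_rTrans_self_mem_biSpan u x 1⟩
  have hexp : f = ∑ y : s, (res f y) • L (Pi.single y 1) := by
    have h1 : L (res f) = f := by
      have := LinearMap.congr_fun hL f
      simpa using this
    conv_lhs => rw [← h1, pi_eq_sum_univ (res f)]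
    simp only [map_sum, map_smul]
    refine Finset.sum_congr rfl fun y _ => ?_
    have hsingle : (fun j : s => if y = j then (1 : ℝ) else 0) = Pi.single y 1 := by
      ext j; simp [Pi.single_apply, eq_comm]
    rw [hsingle]
  have hz := congrArg (fun g : biSpan u => (g : C(G, ℝ)) z) hexp
  simp only [Submodule.coe_sum, Submodule.coe_smul, ContinuousMap.coe_sum,
    Finset.sum_apply, ContinuousMap.coe_smul, Pi.smul_apply, smul_eq_mul] at hz
  have hfz : (f : C(G, ℝ)) z = u (x * z) := rfl
  rw [hfz] at hz
  rw [hz, ← Finset.sum_attach s]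
  refine Finset.sum_congr rfl fun y _ => ?_
  rw [hw y]
  rfl

end Literature.RepresentationTheory.CompactGroups
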